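import Summits.ValiantsHypothesis.ValiantsHypothesis.Theorems.GrenetZeonDualUnipotentThreeHalvesSlowCoreGlueLocal

/-!
# `GrenetZeon.DualUnipotentThreeHalves` (stmt-ValiantsHypothesis-24318) / `TwoDimCoefficients` (stmt-8062):
# THE ENEMY INSIDE — the violator portrait of the expensive constituent of a small representation of `per_n`

✓ `SlowCore.exists_expensive_constituent_of_perPoly_eq_trace` (this seat, `…SlowCoreGlueLocal`) puts inside every representation
`per_n = tr(N^{n−1}·M)` (`N`, `M` affine, `N^m = 0`) of the regime `(c+18)²·m² < n³` an IRREDUCIBLE nilpotent constituent `B` of size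
`b ≥ ⌊√n⌋ + 1` with `¬ RelCert n b B (c·(⌊√n⌋·b))`.  When `N` is LINEAR (the normal form ✓ `exists_nilpotent_pencil_of_dualUnipotentRepr` of a
unipotent-dual representation always is), so is `B`, and `¬ RelCert` transfers to the SUBMODULE currency: the value space `V_B ≤ M_b(ℂ)` of `B`
is EXPENSIVE at budget `c·(⌊√n⌋·b)`, whence the whole VIOLATOR PORTRAIT ✓ `NilSpaceViolatorPortrait.violator_portrait_two` applies to it.

* §1 `relCert_of_window_linear` — a window pair `(W ≤ V_B, k)` of the value space of a LINEAR pencil is a certificate of price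
  `n·k + (dim V_B − dim W)` (the (⇐) half of ✓ `longMassSlowLawAll_linear_iff_submodule`, per pencil); `expensive_of_not_relCert` — hence
  `¬ RelCert n b B P` makes `V_B` expensive at budget `P` (the hypothesis shape `hexp` of the portrait).
* §2 `coeff_zero_conj`, `coeff_zero_classPencil` — constituents of a linear pencil are linear.
* §3 ★★★ `enemy_inside_of_perPoly_eq_trace` — for `per_n = tr(N^{n−1}·M)` with `N` LINEAR nilpotent, `M` affine, `2 ≤ c`, `n ≥ 2`,
  `(c+18)²·m² < n³`: there is an irreducible nilpotent constituent `B` of size `b ≥ ⌊√n⌋ + 1` whose value space `V ≤ M_b(ℂ)` has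
  MASS `dim V > c⌊√n⌋b`, SIZE `C(b,2) > c⌊√n⌋b` (so `b > 2c⌊√n⌋ + 1`), LENGTH (a member with `A^H ≠ 0` whenever `n(H−1) ≤ c⌊√n⌋b`),
  RANK (a member of rank `> c⌊√n⌋`), and WILDNESS (a non-vanishing `V`-word of length `b`, a word of NON-ZERO TRACE, a commutator leaving `V`):
  crit-7 V34 §2's necessary shape of a violator family, realised INSIDE any counterexample to the rung, by name.
* §4 `enemy_inside_of_dualUnipotentRepr` — the same from `DualUnipotentRepr n m`.

HONEST FRAMING.  Composition of landed theorems (`--supports stmt-ValiantsHypothesis-24318 --as helper`); no stub closed: (c)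
`SlowCore.LongMassSlowLawInv`, S3, 24318, `stub_dualUnipotent`/8062, `VP ≠ VNP` are NOT proved.  Def-free, no named-fact hypotheses, no sorry.
[cite: Meshulam1985, Thm. 2 (p. 226)] [cite: deSeguinsPazzis2013Gerstenhaber, Theorem 1] [cite: HornJohnson2013, 2.4.P10 (p0171)]
-/

-- single-conjunct layout: Sub = Summit, duplicated namespace component intended (the name is mandated)
set_option linter.dupNamespace false
set_option autoImplicit false

noncomputable section

namespace Summit.ValiantsHypothesis.ValiantsHypothesis.Theorems.GrenetZeon.SlowCore

open MvPolynomial Matrix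
open scoped BigOperators
open Literature.Computability.AlgebraicComplexity (perPoly)
open Summit.ValiantsHypothesis.ValiantsHypothesis.Cruxes.TwoDimCoefficients.DimTwoCases
  (AffMat IsAffine DualUnipotentRepr exists_nilpotent_pencil_of_dualUnipotentRepr)
open Summit.ValiantsHypothesis.ValiantsHypothesis.Theorems.GrenetZeon.RadicalSplit (lineSubst)
open Summit.ValiantsHypothesis.ValiantsHypothesis.Theorems.GrenetZeon.ResolventFlag (linMat)
open Summit.ValiantsHypothesis.ValiantsHypothesis.Theorems.GrenetZeon.LedgerIndex (exists_linearMap_linMat)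
open Summit.ValiantsHypothesis.ValiantsHypothesis.Theorems.GrenetZeon.LongMassHomogenise
  (map_lineSubst_eq_add_smul codim_comap_eq map_eval_eq_linMat_of_linear)
open Summit.ValiantsHypothesis.ValiantsHypothesis.Theorems.GrenetZeon.PerPencilPrice
  (isAffine_of_isHomogeneous_one coeff_zero_of_isHomogeneous_one finrank_range_le isNilpotent_of_mem_range)
open Summit.ValiantsHypothesis.ValiantsHypothesis.Theorems.GrenetZeon.NilSpaceViolatorPortrait (violator_portrait_two)

variable {n m b : ℕ}

/-! ## §1 Window pairs of the value space of a LINEAR pencil are certificates; `¬ RelCert` ⇒ expensive -/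

/-- A window pair `(W ≤ V, k)` of the value space `V = range T` of a LINEAR pencil `B` is a whole-pencil certificate of `B` of price
`n·k + (dim V − dim W)` (direction space `T⁻¹W`, exact codimension count ✓ `codim_comap_eq`). [this file] -/
theorem relCert_of_window_linear (B : AffMat n b) (hB : IsAffine B) (h0 : ∀ i j, coeff 0 (B i j) = 0)
    (T : (Fin n × Fin n → ℂ) →ₗ[ℂ] Matrix (Fin b) (Fin b) ℂ) (hT : ∀ v, T v = linMat B v)
    (W : Submodule ℂ (Matrix (Fin b) (Fin b) ℂ)) (k : ℕ) (hW : W ≤ LinearMap.range T)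
    (hwin : ∀ A ∈ LinearMap.range T, ∀ w ∈ W, ∀ p : ℕ, p ≤ n - 1 → ∀ i j : Fin b,
      ((((A.map (C : ℂ → MvPolynomial (Fin 1) ℂ) + (X 0 : MvPolynomial (Fin 1) ℂ) • w.map C) ^ p :
        Matrix (Fin b) (Fin b) (MvPolynomial (Fin 1) ℂ)) i j).totalDegree ≤ k)) :
    RelCert n b B (n * k + (Module.finrank ℂ (LinearMap.range T) - Module.finrank ℂ W)) := by
  refine ⟨W.comap T, k, ?_, ?_⟩
  · intro x v hv p hp i j _ _
    rw [map_lineSubst_eq_add_smul B hB h0]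
    have hvW : linMat B v ∈ W := by rw [← hT]; exact Submodule.mem_comap.mp hv
    exact hwin (linMat B x) (by rw [← hT]; exact LinearMap.mem_range_self T x) (linMat B v) hvW p hp i j
  · rw [codim_comap_eq T W hW]

/-- `¬ RelCert n b B P` for a LINEAR pencil ⇒ its value space is EXPENSIVE at budget `P` (the `hexp` shape of the violator portrait). [this file] -/
theorem expensive_of_not_relCert (B : AffMat n b) (hB : IsAffine B) (h0 : ∀ i j, coeff 0 (B i j) = 0)
    (T : (Fin n × Fin n → ℂ) →ₗ[ℂ] Matrix (Fin b) (Fin b) ℂ) (hT : ∀ v, T v = linMat B v) {P : ℕ} (hP : ¬ RelCert n b B P) :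
    ∀ (W : Submodule ℂ (Matrix (Fin b) (Fin b) ℂ)) (k : ℕ), W ≤ LinearMap.range T →
      (∀ A ∈ LinearMap.range T, ∀ w ∈ W, ∀ p : ℕ, p ≤ n - 1 → ∀ i j : Fin b,
        ((((A.map (C : ℂ → MvPolynomial (Fin 1) ℂ) + (X 0 : MvPolynomial (Fin 1) ℂ) • w.map C) ^ p :
          Matrix (Fin b) (Fin b) (MvPolynomial (Fin 1) ℂ)) i j).totalDegree ≤ k)) →
      P < n * k + (Module.finrank ℂ (LinearMap.range T) - Module.finrank ℂ W) := by
  intro W k hW hwin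
  by_contra hle
  push Not at hle
  exact hP (Ceilings.relCert_mono (relCert_of_window_linear B hB h0 T hT W k hW hwin) hle)

/-! ## §2 Constituents of a linear pencil are linear -/

/-- Constant conjugation preserves "no constant terms". -/
theorem coeff_zero_conj (N : AffMat n m) (h0 : ∀ i j, coeff 0 (N i j) = 0) (G G' : Matrix (Fin m) (Fin m) ℂ) (i j : Fin m) :
    coeff 0 ((G.map C * N * G'.map C : AffMat n m) i j) = 0 := by
  have hN0 : N.map (constantCoeff : MvPolynomial (Fin n × Fin n) ℂ →+* ℂ) = 0 := by
    ext a c; rw [Matrix.map_apply, constantCoeff_eq, h0]; rfl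
  have h := congr_fun (congr_fun (show (G.map C * N * G'.map C : AffMat n m).map
      (constantCoeff : MvPolynomial (Fin n × Fin n) ℂ →+* ℂ) = 0 by
    rw [Matrix.map_mul, Matrix.map_mul, hN0, Matrix.mul_zero, Matrix.zero_mul]) i) j
  rw [Matrix.map_apply, constantCoeff_eq] at h
  exact h

/-- A class pencil of a pencil without constant terms has no constant terms. -/
theorem coeff_zero_classPencil {lvl : Fin m → ℕ} {t : ℕ} (N' : AffMat n m) (h0 : ∀ i j, coeff 0 (N' i j) = 0)
    (e : {i : Fin m // lvl i = t} ≃ Fin b) (i j : Fin b) : coeff 0 (classPencil N' e i j) = 0 :=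
  h0 _ _

/-- The values of a nilpotent linear pencil (`B^b = 0`) are nilpotent (value-map form). -/
theorem isNilpotent_values (B : AffMat n b) (hB : IsAffine B) (h0 : ∀ i j, coeff 0 (B i j) = 0) (hnil : B ^ b = 0)
    (T : (Fin n × Fin n → ℂ) →ₗ[ℂ] Matrix (Fin b) (Fin b) ℂ) (hT : ∀ v, T v = linMat B v) :
    ∀ A ∈ LinearMap.range T, IsNilpotent A :=
  isNilpotent_of_mem_range B hB h0 hnil T hT

/-! ## §3 The enemy inside a small representation -/

/-- ★★★ **THE ENEMY INSIDE.**  Let `per_n = tr(N^{n−1}·M)` with `N` LINEAR (affine, no constant terms) and nilpotent (`N^m = 0`), `M` affine,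
`n ≥ 2`, `2 ≤ c`, `(c+18)²·m² < n³`.  Then some irreducible nilpotent CONSTITUENT `B` of `N` (class pencil of a level-cut conjugate) of size
`b ≥ ⌊√n⌋ + 1` is LINEAR with value map `T`, violates (c) at constant `c`, and its value space `V = range T ≤ M_b(ℂ)` shows the full violator
portrait at budget `c·(⌊√n⌋·b)`: mass, size, length, rank, a non-zero word of length `b`, a word of non-zero trace, a commutator leaving `V`.
[this file] -/
theorem enemy_inside_of_perPoly_eq_trace (c : ℕ) (hc : 2 ≤ c) (hn2 : 2 ≤ n) (hreg : (c + 18) ^ 2 * m ^ 2 < n ^ 3)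
    (N M : AffMat n m) (hN : IsAffine N) (h0 : ∀ i j, coeff 0 (N i j) = 0) (hnil : N ^ m = 0) (hM : IsAffine M)
    (hper : perPoly (Fin n) ℂ = (N ^ (n - 1) * M).trace) :
    ∃ (b : ℕ) (B : AffMat n b) (G G' : Matrix (Fin m) (Fin m) ℂ) (lvl : Fin m → ℕ) (t : ℕ) (e : {i : Fin m // lvl i = t} ≃ Fin b)
      (T : (Fin n × Fin n → ℂ) →ₗ[ℂ] Matrix (Fin b) (Fin b) ℂ),
      G' * G = 1 ∧ G * G' = 1 ∧ LevelCut (G.map C * N * G'.map C) lvl ∧ B = classPencil (G.map C * N * G'.map C) e ∧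
      IsAffine B ∧ (∀ i j, coeff 0 (B i j) = 0) ∧ B ^ b = 0 ∧ IrreducibleInv B ∧ Nat.sqrt n + 1 ≤ b ∧
      ¬ RelCert n b B (c * (Nat.sqrt n * b)) ∧ (∀ v, T v = linMat B v) ∧
      (c * (Nat.sqrt n * b) < Module.finrank ℂ (LinearMap.range T) ∧
        c * (Nat.sqrt n * b) < b.choose 2 ∧
        (∀ H : ℕ, 1 ≤ H → n * (H - 1) ≤ c * (Nat.sqrt n * b) → ∃ A ∈ LinearMap.range T, A ^ H ≠ 0) ∧
        (∃ A ∈ LinearMap.range T, c * Nat.sqrt n < A.rank) ∧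
        (∃ w : Fin b → Matrix (Fin b) (Fin b) ℂ, (∀ s, w s ∈ LinearMap.range T) ∧ (List.ofFn w).prod ≠ 0) ∧
        (∃ (s : ℕ) (w : Fin (s + 1) → Matrix (Fin b) (Fin b) ℂ), (∀ r, w r ∈ LinearMap.range T) ∧
          ((List.ofFn w).prod).trace ≠ 0) ∧
        (∃ A ∈ LinearMap.range T, ∃ A' ∈ LinearMap.range T, A * A' - A' * A ∉ LinearMap.range T)) := by
  obtain ⟨b, B, G, G', lvl, t, e, hGG, hGG', hcut, hBe, hBaff, hBnil, hirr, hb, hnot⟩ :=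
    exists_expensive_constituent_of_perPoly_eq_trace c hn2 hreg N M hN hnil hM hper
  have hB0 : ∀ i j, coeff 0 (B i j) = 0 := by
    intro i j; rw [hBe]; exact coeff_zero_classPencil _ (coeff_zero_conj N h0 G G') e i j
  obtain ⟨T, hT⟩ := exists_linearMap_linMat B
  have hexp := expensive_of_not_relCert B hBaff hB0 T hT hnot
  have hportrait := violator_portrait_two (LinearMap.range T) (isNilpotent_values B hBaff hB0 hBnil T hT) n c
    (finrank_range_le T) hc hexp
  exact ⟨b, B, G, G', lvl, t, e, T, hGG, hGG', hcut, hBe, hBaff, hB0, hBnil, hirr, hb, hnot, hT, hportrait⟩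

/-! ## §4 In the stub's currency -/

/-- ★★ **THE ENEMY INSIDE a unipotent-dual representation.**  `DualUnipotentRepr n m` with `(c+18)²·m² < n³`, `2 ≤ c`, `n ≥ 2` yields a LINEAR
nilpotent pencil `N` with `per_n = tr(N^{n−1}·M)` and, inside it, an irreducible nilpotent constituent of size `> √n` violating (c) at `c` and
showing the full violator portrait. [this file] -/
theorem enemy_inside_of_dualUnipotentRepr (c : ℕ) (hc : 2 ≤ c) (hn2 : 2 ≤ n) (hreg : (c + 18) ^ 2 * m ^ 2 < n ^ 3)
    (h : DualUnipotentRepr n m) :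
    ∃ (N M : AffMat n m), IsAffine N ∧ (∀ i j, coeff 0 (N i j) = 0) ∧ N ^ m = 0 ∧ IsAffine M ∧
      perPoly (Fin n) ℂ = (N ^ (n - 1) * M).trace ∧
    ∃ (b : ℕ) (B : AffMat n b) (G G' : Matrix (Fin m) (Fin m) ℂ) (lvl : Fin m → ℕ) (t : ℕ) (e : {i : Fin m // lvl i = t} ≃ Fin b)
      (T : (Fin n × Fin n → ℂ) →ₗ[ℂ] Matrix (Fin b) (Fin b) ℂ),
      G' * G = 1 ∧ G * G' = 1 ∧ LevelCut (G.map C * N * G'.map C) lvl ∧ B = classPencil (G.map C * N * G'.map C) e ∧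
      IsAffine B ∧ (∀ i j, coeff 0 (B i j) = 0) ∧ B ^ b = 0 ∧ IrreducibleInv B ∧ Nat.sqrt n + 1 ≤ b ∧
      ¬ RelCert n b B (c * (Nat.sqrt n * b)) ∧ (∀ v, T v = linMat B v) ∧
      (c * (Nat.sqrt n * b) < Module.finrank ℂ (LinearMap.range T) ∧
        c * (Nat.sqrt n * b) < b.choose 2 ∧
        (∀ H : ℕ, 1 ≤ H → n * (H - 1) ≤ c * (Nat.sqrt n * b) → ∃ A ∈ LinearMap.range T, A ^ H ≠ 0) ∧
        (∃ A ∈ LinearMap.range T, c * Nat.sqrt n < A.rank) ∧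
        (∃ w : Fin b → Matrix (Fin b) (Fin b) ℂ, (∀ s, w s ∈ LinearMap.range T) ∧ (List.ofFn w).prod ≠ 0) ∧
        (∃ (s : ℕ) (w : Fin (s + 1) → Matrix (Fin b) (Fin b) ℂ), (∀ r, w r ∈ LinearMap.range T) ∧
          ((List.ofFn w).prod).trace ≠ 0) ∧
        (∃ A ∈ LinearMap.range T, ∃ A' ∈ LinearMap.range T, A * A' - A' * A ∉ LinearMap.range T)) := by
  obtain ⟨N, M, hN, hM, hnil, hper⟩ := exists_nilpotent_pencil_of_dualUnipotentRepr (by omega) h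
  have hNa := isAffine_of_isHomogeneous_one N hN
  have hMa := isAffine_of_isHomogeneous_one M hM
  have h0 := coeff_zero_of_isHomogeneous_one N hN
  exact ⟨N, M, hNa, h0, hnil, hMa, hper, enemy_inside_of_perPoly_eq_trace c hc hn2 hreg N M hNa h0 hnil hMa hper⟩

end Summit.ValiantsHypothesis.ValiantsHypothesis.Theorems.GrenetZeon.SlowCore

end
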